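import Literature.NumberTheory.LFunctions.CriticalLineTwoThirdsTheoremAProofs
import Literature.NumberTheory.LFunctions.UnconditionalPairCorrelation
import HarnessLib

/-!
# RH-FREE — «nothing here bears on the truth of RH»: four simple-zero facts of the tree DISCHARGED through [AF26] Theorem A (Anderson 1983 / Titchmarsh (10.29.1); Baluyot–Goldston–Suriajaya–Turnage-Butterbaugh 2024 Theorems 2–3; the conclusion of GLSS 2026 Corollary 2)

Topic `Literature/NumberTheory/LFunctions` (namespace `Literature.NumberTheory.LFunctions`).
Cell `rh-columns/lit`, unit `rh-lit-frontier-1` (gen 9). This file has NO definition, NO claim and NO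
`sorry`; every theorem is a short composition of theorems already in the tree.

## What this file records

Since gen 8 of this unit the tree holds, with the standard axioms only, the two cumulative forms of
**[AF26] Theorem A** (L. Alpöge, R. Furman, arXiv:2608.13637v2, UNREFEREED preprint, D-0012) for the
typed model:

* `AlpogeFurman2026_simple_critical_holds`: for every `ε > 0` and all large `T`,
  `(2/3 − ε) N(T) ≤ N⁽¹⁾(T)` (`N⁽¹⁾ = simpleCriticalZeroCount`, simple zeros ON the line);
* `AlpogeFurman2026_distinct_holds`: for every `ε > 0` and all large `T`, `(5/6 − ε) N(T) ≤ N_d(T)`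
  (`N_d = distinctZeroCount`).

Four further Prop-valued statements of the tree, typed earlier from OTHER sources and so far fed to
their users as hypotheses, are consequences of these two kernel theorems by counting alone; this file
proves them (net effect: the users of `(h : X)` below can be fed `X_holds`).

1. `Anderson1983_levinson_simple` (`SimpleZeros.lean`; Titchmarsh (10.29.1) with Anderson's
   `α = 0.3532`): `0.3532 N(T) ≤ N⁽¹⁾(T) − Σ_{r≥3} (r − 2) N⁽ʳ⁾(T)` for all large `T`. The one
   counting input is `Σ_{r≥3}(r−2)N⁽ʳ⁾(T) ≤ N(T) − N_d(T)` (`levinsonCorrection_le_sub_distinctZeroCount`: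
   a zero of multiplicity `m ≥ 3` on the line contributes `m − 2 ≤ m − 1` to the left and `m − 1` to the
   right), after which `(2/3 − ε) − (1/6 + ε) = 1/2 − 2ε ≥ 0.3532` for `ε = 1/20`. Its in-tree users
   (`ZeroCountingLevinsonProofs.lean`: `le_criticalLineProportion_of_anderson`,
   `one_third_le_criticalLineProportion_of_anderson`, `criticalLineProportion_pos_of_anderson`;
   `SimpleZerosLevinsonProofs.lean` reduces it instead to a mollified mean square) become unconditional.
2. `baluyotEtAl2024_theorem2` (`UnconditionalPairCorrelation.lean`; BGST 2024 Theorem 2: the thin-box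
   hypothesis at `T` ⟹ `(0.617 − ε) N(T) ≤ N_s(T)`, `N_s = simpleZeroCount` = simple zeros anywhere in
   the strip): the CONCLUSION holds for all large `T` whatever the hypothesis, since
   `N⁽¹⁾ ≤ N_s` (`GLSS2026.simpleCriticalZeroCount_le_simpleZeroCount`) and `0.617 < 2/3`.
3. `baluyotEtAl2024_theorem3` (BGST 2024 Theorem 3: a zero-density hypothesis ⟹
   `BGSTB2024.SimpleProportion 0.617`): likewise, via `BGSTB2024.simpleProportion_of_le_two_thirds`
   (`SimpleProportion c` for every `c ≤ 2/3`, unconditionally).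
4. `GLSS2026.HalfSimpleHalfOnLine` (`AlternativeHypothesisConsequences.lean`; the conclusion of
   Goldston–Lee–Schettler–Suriajaya 2026 Corollary 2, there derived from AH-Pairs + (AH1):
   eventually `(1/2 − ε)N ≤ N_s` and `(1/2 − ε)N ≤ N₀`): holds outright (`1/2 < 2/3`,
   `N⁽¹⁾ ≤ N_s`, `N⁽¹⁾ ≤ N₀`).

What is NOT implied by Theorem A and stays a named fact (checked, recorded for the census): the
RH-conditional records `BuiHeathbrown2013_simple_zeros` (`19/27 > 2/3`), `BuiHeathbrown2013_distinct_zeros`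
(`0.84665 > 5/6`), `chirreGoncalvesDeLaat2020_*` (`0.6792`, `0.8477`, `N*`-bounds), `CheerGoldston1993_sum_multiplicity`
and every `N* = Σ m_ρ²` bound (Theorem A controls `Σ (m_ρ − 1)`, not `Σ m_ρ(m_ρ − 1)`),
`SimonicTrudgianTurnageButterbaugh2022_thm4` (exponential decay in the multiplicity `j`; Theorem A (ii)
gives only `N_j(T) ≤ (1/6 + ε) N(T)/(j − 1)`), `wu2019_theorem2` (all Dirichlet characters), and the
`100 %` statements (`GLSS2026.AlmostAllSimpleOnLine`, `SimpleZerosConjecture`).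

STATUS NOTE (no endorsement). [AF26] is an unrefereed 2026 preprint; what is used here is the tree's
own kernel proof of its Theorem A for the typed model (`CriticalLineTwoThirds*Proofs.lean`, gens 6–8 of
this unit, standard axioms), composed with counting inequalities between the tree's zero-counting
functions. The four discharged statements keep their original citations; this file adds no claim about
any source. `#print axioms` of every theorem here: `propext`, `Classical.choice`, `Quot.sound`.
Nothing here bears on the truth of RH.

## References
* [AlpogeFurman2026] L. Alpöge, R. Furman, *More than two thirds of the zeros of the Riemann zeta
  function are simple and on the critical line*, arXiv:2608.13637v2 (2026): Theorem A (p. 1), p. 2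
  ("the same holds for `(0,T)`"), §1.3 (records, p. 2).
* [Titchmarsh1986] E. C. Titchmarsh, *The theory of the Riemann zeta-function*, 2nd ed. (rev.
  D. R. Heath-Brown), Oxford 1986: §10.29, eq. (10.29.1) (Anderson's `α = 0.3532`).
* [Anderson1983] R. J. Anderson, *Simple zeros of the Riemann zeta-function*, J. Number Theory 17 (1983)
  176–182.
* [BaluyotEtAl2024] S. A. C. Baluyot, D. A. Goldston, A. I. Suriajaya, C. L. Turnage-Butterbaugh, *An
  unconditional Montgomery theorem for pair correlation of zeros of the Riemann zeta-function*, Acta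
  Arith. 214 (2024) 357–376: Theorems 2 and 3.
* [GoldstonLeeSchettlerSuriajaya2026] D. A. Goldston, J. Lee, J. Schettler, A. I. Suriajaya, *Pair
  correlation conjecture for the zeros of the Riemann zeta-function II: the Alternative Hypothesis*,
  J. Number Theory 291 (2027) 49–64: Corollary 2 and §4.
-/

noncomputable section

namespace Literature.NumberTheory.LFunctions

open Filter Topology

/-! ## The counting input: `Σ_{r ≥ 3} (r − 2) N⁽ʳ⁾(T) ≤ N(T) − N_d(T)` -/

/-- `N(T) − N_d(T) = Σ_{ρ distinct, 0 < γ ≤ T} (m(ρ) − 1)`: counting with multiplicity minus counting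
once, as a finite sum over the box `zetaZeroBox 0 T`. [cite: Titchmarsh1986, §9.1, §10.29] -/
theorem zetaZeroCount_sub_distinctZeroCount_eq_sum (T : ℝ) :
    (zetaZeroCount T : ℝ) - distinctZeroCount T =
      ∑ ρ ∈ (zetaZeroBox_finite 0 T).toFinset, ((riemannZetaZeroOrder ρ : ℝ) - 1) := by
  have hB : (zetaZeroBox 0 T).Finite := zetaZeroBox_finite 0 T
  have hN : (zetaZeroCount T : ℝ) = ∑ ρ ∈ hB.toFinset, (riemannZetaZeroOrder ρ : ℝ) := by
    have h := zetaZeroCount_eq_finsum T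
    rw [finsum_mem_eq_finite_toFinset_sum _ hB] at h
    have h' : (((zetaZeroCount T : ℕ) : ℤ) : ℝ) = ((∑ ρ ∈ hB.toFinset, riemannZetaZeroOrder ρ : ℤ) : ℝ) := by
      rw [h]
    push_cast at h'
    exact h'
  have hNd : (distinctZeroCount T : ℝ) = ∑ ρ ∈ hB.toFinset, (1 : ℝ) := by
    rw [distinctZeroCount, Set.ncard_eq_toFinset_card _ hB, Finset.sum_const, nsmul_eq_mul, mul_one]
  rw [hN, hNd, ← Finset.sum_sub_distrib]

/-- **`Σ_{r ≥ 3} (r − 2) N⁽ʳ⁾(T) ≤ N(T) − N_d(T)`**: the correction term of Titchmarsh's (10.29.1)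
(`levinsonCorrection`, regrouped by `levinsonCorrection_eq_finsum_zeros` as
`Σ_{ρ on the line, m(ρ) ≥ 3} (m(ρ) − 2)`) is at most `Σ_{all distinct ρ} (m(ρ) − 1) = N(T) − N_d(T)`,
termwise (`m − 2 ≤ m − 1`, and `m(ρ) − 1 ≥ 0` on the box). [cite: Titchmarsh1986, §10.29 (10.29.1)] -/
theorem levinsonCorrection_le_sub_distinctZeroCount (T : ℝ) :
    levinsonCorrection T ≤ (zetaZeroCount T : ℝ) - distinctZeroCount T := by
  rw [levinsonCorrection_eq_finsum_zeros, zetaZeroCount_sub_distinctZeroCount_eq_sum]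
  set S : Set ℂ := {ρ ∈ zetaZeroBox (1 / 2) T | ρ.re = 1 / 2 ∧ 3 ≤ riemannZetaZeroOrder ρ} with hSdef
  have hB : (zetaZeroBox 0 T).Finite := zetaZeroBox_finite 0 T
  have hSB : S ⊆ zetaZeroBox 0 T := by
    rintro ρ ⟨⟨h0, -, h2, h3, h4⟩, h5, -⟩
    exact ⟨h0, by rw [h5]; norm_num, h2, h3, h4⟩
  have hS : S.Finite := hB.subset hSB
  rw [finsum_mem_eq_finite_toFinset_sum _ hS]
  calc ∑ ρ ∈ hS.toFinset, ((riemannZetaZeroOrder ρ : ℝ) - 2)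
      ≤ ∑ ρ ∈ hS.toFinset, ((riemannZetaZeroOrder ρ : ℝ) - 1) :=
        Finset.sum_le_sum fun ρ _ ↦ by linarith
    _ ≤ ∑ ρ ∈ hB.toFinset, ((riemannZetaZeroOrder ρ : ℝ) - 1) := by
        refine Finset.sum_le_sum_of_subset_of_nonneg (fun ρ hρ ↦ ?_) fun ρ hρ _ ↦ ?_
        · rw [Set.Finite.mem_toFinset] at hρ ⊢
          exact hSB hρ
        · rw [Set.Finite.mem_toFinset] at hρ
          have h1 : (1 : ℤ) ≤ riemannZetaZeroOrder ρ :=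
            DiophantineGeometry.riemannZetaZeroOrder_pos_of_mem_zetaZeroBox hρ
          have h1' : (1 : ℝ) ≤ riemannZetaZeroOrder ρ := by exact_mod_cast h1
          linarith

/-! ## 1. Anderson 1983 / Titchmarsh (10.29.1) DISCHARGED -/

/-- **The named fact `Anderson1983_levinson_simple` (Titchmarsh (10.29.1) with `α = 0.3532`) DISCHARGED**
— here NOT by Levinson's method but as a counting consequence of the tree's kernel theorems
`AlpogeFurman2026_simple_critical_holds` (`N⁽¹⁾ ≥ (2/3 − ε)N`) and `AlpogeFurman2026_distinct_holds`
(`N_d ≥ (5/6 − ε)N`): with `ε = 1/20`, `N⁽¹⁾(T) − Σ_{r≥3}(r−2)N⁽ʳ⁾(T) ≥ (37/60)N − (N − (47/60)N) = (2/5)N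
≥ 0.3532 N` for all large `T`. [cite: Titchmarsh1986, §10.29 (10.29.1)] [cite: AlpogeFurman2026, Theorem A (p. 1) and §1.3 (p. 2)] -/
theorem Anderson1983_levinson_simple_holds : Anderson1983_levinson_simple := by
  have h1 := AlpogeFurman2026_simple_critical_holds (1 / 20) (by norm_num)
  have h2 := AlpogeFurman2026_distinct_holds (1 / 20) (by norm_num)
  obtain ⟨T₀, hT₀⟩ := Filter.eventually_atTop.1 (h1.and h2)
  refine ⟨T₀, fun T hT ↦ ?_⟩
  obtain ⟨hs, hd⟩ := hT₀ T hT
  have hc := levinsonCorrection_le_sub_distinctZeroCount T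
  have hN : (0 : ℝ) ≤ zetaZeroCount T := Nat.cast_nonneg _
  rw [criticalZeroCountOfOrder_one]
  nlinarith

/-- With the fact discharged, its in-tree consequence `κ ≥ 0.3532` (`le_criticalLineProportion_of_anderson`,
`ZeroCountingLevinsonProofs.lean`) is unconditional (of course weaker than `two_thirds_le_criticalLineProportion`).
[cite: Titchmarsh1986, §10.29] -/
theorem le_criticalLineProportion_anderson : (0.3532 : ℝ) ≤ criticalLineProportion :=
  le_criticalLineProportion_of_anderson Anderson1983_levinson_simple_holds

/-! ## 2–3. Baluyot–Goldston–Suriajaya–Turnage-Butterbaugh 2024, Theorems 2 and 3 DISCHARGED -/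

namespace BGSTB2024

/-- **`SimpleProportion c` for every `c ≤ 2/3`, unconditionally**: for every `ε > 0` and all large `T`,
`(c − ε) N(T) ≤ N_s(T)` — from `N_s ≥ N⁽¹⁾ ≥ (2/3 − ε)N` (`AlpogeFurman2026_simple_critical_holds.simple`).
[cite: BaluyotEtAl2024, Theorems 2–3 (the predicate "at least a proportion c of the zeros are simple")] [cite: AlpogeFurman2026, Theorem A (p. 1), last sentence] -/
theorem simpleProportion_of_le_two_thirds {c : ℝ} (hc : c ≤ 2 / 3) : SimpleProportion c := by
  intro ε hε
  obtain ⟨T₀, hT₀⟩ :=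
    Filter.eventually_atTop.1 (AlpogeFurman2026_simple_critical_holds.simple ε hε)
  refine ⟨T₀, fun T hT ↦ ?_⟩
  have h := hT₀ T hT
  have hN : (0 : ℝ) ≤ zetaZeroCount T := Nat.cast_nonneg _
  nlinarith

/-- In particular `SimpleProportion (2/3)` and the papers' `SimpleProportion 0.617`.
[cite: BaluyotEtAl2024, Theorems 2–3] [cite: AlpogeFurman2026, Theorem A (p. 1)] -/
theorem simpleProportion_two_thirds : SimpleProportion (2 / 3) ∧ SimpleProportion 0.617 :=
  ⟨simpleProportion_of_le_two_thirds le_rfl, simpleProportion_of_le_two_thirds (by norm_num)⟩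

end BGSTB2024

/-- **The named fact `baluyotEtAl2024_theorem2` (BGST 2024 Theorem 2: thin box at `T` ⟹ at least
`61.7 %` of the zeros up to `T` are simple) DISCHARGED** — its conclusion holds for all large `T`
without the thin-box hypothesis, by `BGSTB2024.simpleProportion_of_le_two_thirds` (`0.617 ≤ 2/3`).
The printed theorem (pair-correlation method under the thin-box hypothesis) is of course a different
ARGUMENT; only the typed statement is settled here. [cite: BaluyotEtAl2024, Theorem 2] [cite: AlpogeFurman2026, Theorem A (p. 1)] -/
theorem baluyotEtAl2024_theorem2_holds : baluyotEtAl2024_theorem2 := by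
  intro ε hε
  obtain ⟨T₀, hT₀⟩ := BGSTB2024.simpleProportion_of_le_two_thirds (c := 0.617) (by norm_num) ε hε
  exact ⟨T₀, fun T hT _ ↦ hT₀ T hT⟩

/-- **The named fact `baluyotEtAl2024_theorem3` (BGST 2024 Theorem 3: `N(σ,T) = o(T^{2(1−σ)})` on
`½ + 1/(2 log T) ≤ σ ≤ 25/32 + η` ⟹ `SimpleProportion 0.617`) DISCHARGED** — the conclusion holds
unconditionally (`BGSTB2024.simpleProportion_two_thirds`). [cite: BaluyotEtAl2024, Theorem 3] [cite: AlpogeFurman2026, Theorem A (p. 1)] -/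
theorem baluyotEtAl2024_theorem3_holds : baluyotEtAl2024_theorem3 :=
  fun _ _ _ ↦ BGSTB2024.simpleProportion_two_thirds.2

/-! ## 4. The conclusion of GLSS 2026 Corollary 2 holds outright -/

/-- **`GLSS2026.HalfSimpleHalfOnLine` holds unconditionally**: for every `ε > 0`, eventually
`(1/2 − ε) N(T) ≤ N_s(T)` and `(1/2 − ε) N(T) ≤ N₀(T)` — from `N_s, N₀ ≥ N⁽¹⁾ ≥ (2/3 − ε)N ≥ (1/2 − ε)N`
(`AlpogeFurman2026_simple_critical_holds.simple/.critical`). In Goldston–Lee–Schettler–Suriajaya 2026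
this is the conclusion of Corollary 2, derived there from AH-Pairs and (AH1) (`glss2026_corollary2`);
the kernel theorem below says that conclusion needs no hypothesis. [cite: GoldstonLeeSchettlerSuriajaya2026, §1 Corollary 2 and §4] [cite: AlpogeFurman2026, Theorem A (p. 1), last sentence] -/
theorem GLSS2026.HalfSimpleHalfOnLine_holds : GLSS2026.HalfSimpleHalfOnLine := by
  intro ε hε
  filter_upwards [AlpogeFurman2026_simple_critical_holds.simple ε hε,
    AlpogeFurman2026_simple_critical_holds.critical ε hε] with T hs hc
  have hN : (0 : ℝ) ≤ zetaZeroCount T := Nat.cast_nonneg _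
  constructor <;> nlinarith

end Literature.NumberTheory.LFunctions

end
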